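import Summits.Ventures.YMGap.RobustBall.HeatBathConcentrationDLR
import Summits.Ventures.YMGap.Thresholds.OneLinkModulusSU3Twisted
import Literature.MathematicalPhysics.QuantumFieldTheory.Balaban1983to89.StrongCouplingKernelWindow
import Literature.MathematicalPhysics.QuantumLattice.LatticeGaugeDLRGibbsProofs
import HarnessLib

/-!
# Robust ball (Y2) — concentration in every Gibbs state: every-`SU(N)` (Bakry–Émery modulus), `SU(3)` (twisted modulus) and LIMIT-STATE cells

HONEST FRAMING: venture file of the cell `pub-ymgap` (QuantumFields programme), track ROBUST-BALL, seat rb-p2 (g14); cells of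
`HeatBathConcentrationDLR.gibbs_measureReal_deviation_ge_le_of_oneLinkKRModulus` (exponential concentration of local Lipschitz observables in EVERY DLR state
of the Wilson specification, `d = 4`).  LATTICE statements at STRONG COUPLING, Wilson action (class K); nothing about `β → ∞`, the continuum or Clay.
* `suN_gibbs_measureReal_deviation_ge_le_bakryEmery` ∕ `_le_le_…` — EVERY `SU(N)`, `N ≥ 2`, HYPOTHESIS-FREE on 't Hooft `0 ≤ b < 1/48` (bare `Nb`; Bakry–Émery one-link
  modulus, `1 − c = (1/2 − 24b)/(1/2 − 6b)`): for EVERY DLR state, `μ{±(F − E_μF) ≥ r} ≤ e^{2/3} exp(−r/√(2(2(1 − c))⁻¹ ∑ δ²))` with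
  `(2(1 − c))⁻¹ = (1/2 − 6b)/(1 − 48b)`;
* `su3_gibbs_measureReal_deviation_ge_le_pv2t` ∕ `_le_le_…` — `SU(3)`, twisted modulus `OneLinkKRModulus 3 (1/5) (3531/2000)`, `0 ≤ β_W < 1000/3531` (tree coupling
  `β_W/3`): constant `(2(1 − 3531β_W/1000))⁻¹`;
* `su2_limit_measureReal_deviation_ge_le` ∕ `_le_le` — `SU(2)`, `d = 4`, `0 ≤ β_W < 2/9`: the SAME bound for every tight infinite-volume LIMIT of the torus Wilson
  states (every limit point is a DLR state — Georgii Thm. 4.17, `mem_ymGibbsMeasures_of_mem_infiniteVolumeLimitPoints_holds`), for Lipschitz cylinders.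
0 sorry, 0 definitions.  Everything here is proved. [folklore]
-/

noncomputable section

open MeasureTheory Function Real Finset ProbabilityTheory Filter Topology
open scoped NNReal
open Summit.QuantumFields.YangMills.Theorems.StrongPinningPoincare
open Literature.Probability.LatticeModels Literature.Probability.LatticeModels.DobrushinMetric
open Literature.MathematicalPhysics.QuantumLattice hiding torusNorm
open Literature.MathematicalPhysics.QuantumFieldTheory hiding ZdEdge
open Literature.MathematicalPhysics.QuantumFieldTheory.Balaban1983to89.StrongCouplingDobrushinWindow (OneLinkKRModulus)

namespace Summit.Ventures.YMGap.RobustBall.HeatBathConcentration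

variable {N : ℕ}

/-- **EVERY `SU(N)`, `N ≥ 2`, `d = 4`, HYPOTHESIS-FREE on 't Hooft `0 ≤ b < 1/48`, upper tail**: for every DLR state `μ` (bare coupling `Nb`), every Lipschitz cylinder `F`
on `Δ` with link oscillations `δ_x` (`∑ δ_x² > 0`) and every `r`, `μ{F − E_μ F ≥ r} ≤ e^{2/3} exp(−r/√(2((1/2 − 6b)/(1 − 48b)) ∑ δ_x²))`. [folklore] -/
theorem suN_gibbs_measureReal_deviation_ge_le_bakryEmery (hN : 2 ≤ N) {b : ℝ} (hb0 : 0 ≤ b) (hb : b < 1 / 48)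
    {μ : Measure (LGConfig 4 (Matrix.specialUnitaryGroup (Fin N) ℂ))} (hμ : μ ∈ ymGibbsMeasures (d := 4) (fundamentalRep (Fin N)) ((N : ℝ) * b))
    {F : LGConfig 4 (Matrix.specialUnitaryGroup (Fin N) ℂ) → ℝ} {Δ : Finset (ZdEdge 4)} {KF : ℝ≥0}
    (hF : IsLipschitzCylinder (fundamentalRep (Fin N)) F Δ KF) (δ : ZdEdge 4 → ℝ)
    (hδ : ∀ x ∈ Δ, ∀ U s, |F U - F (update U x s)| ≤ δ x) (hD : 0 < ∑ x ∈ Δ, δ x ^ 2) (r : ℝ) :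
    μ.real {U | r ≤ F U - ∫ U', F U' ∂μ} ≤ Real.exp (2 / 3) * Real.exp (-r / Real.sqrt (2 * ((1 / 2 - 6 * b) / (1 - 48 * b)) * ∑ x ∈ Δ, δ x ^ 2)) := by
  have habs : |b| = b := abs_of_nonneg hb0
  have hden : 0 < 1 / 2 - 6 * b := by linarith
  have hc1 : 18 * b / (1 / 2 - 6 * b) < 1 := by rw [div_lt_one hden]; linarith
  have key := gibbs_measureReal_deviation_ge_le_of_oneLinkKRModulus (d := 4) (N := N) (by norm_num) (by omega) (β := b) (K := 1 / (1 / 2 - 6 * b))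
    (by positivity) (R := 6 * b) (by rw [habs]; push_cast; linarith) (Balaban1983to89.StrongCouplingKernelWindow.oneLinkKRModulus_SU hN (by linarith))
    (c := 18 * b / (1 / 2 - 6 * b)) (by rw [habs]; push_cast; exact le_of_eq (by field_simp; ring)) hc1 hμ hF δ hδ hD r
  have e : (2 * (1 - 18 * b / (1 / 2 - 6 * b)))⁻¹ = (1 / 2 - 6 * b) / (1 - 48 * b) := by
    have e1 : 2 * (1 - 18 * b / (1 / 2 - 6 * b)) = (1 - 48 * b) / (1 / 2 - 6 * b) := by
      rw [eq_div_iff hden.ne']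
      have : 18 * b / (1 / 2 - 6 * b) * (1 / 2 - 6 * b) = 18 * b := div_mul_cancel₀ _ hden.ne'
      nlinarith [this]
    rw [e1, inv_div]
  rw [e] at key
  exact key

/-- **EVERY `SU(N)`, 't Hooft `0 ≤ b < 1/48`, lower tail**: `μ{F − E_μ F ≤ −r} ≤ e^{2/3} exp(−r/√(2((1/2 − 6b)/(1 − 48b)) ∑ δ_x²))`. [folklore] -/
theorem suN_gibbs_measureReal_deviation_le_le_bakryEmery (hN : 2 ≤ N) {b : ℝ} (hb0 : 0 ≤ b) (hb : b < 1 / 48)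
    {μ : Measure (LGConfig 4 (Matrix.specialUnitaryGroup (Fin N) ℂ))} (hμ : μ ∈ ymGibbsMeasures (d := 4) (fundamentalRep (Fin N)) ((N : ℝ) * b))
    {F : LGConfig 4 (Matrix.specialUnitaryGroup (Fin N) ℂ) → ℝ} {Δ : Finset (ZdEdge 4)} {KF : ℝ≥0}
    (hF : IsLipschitzCylinder (fundamentalRep (Fin N)) F Δ KF) (δ : ZdEdge 4 → ℝ)
    (hδ : ∀ x ∈ Δ, ∀ U s, |F U - F (update U x s)| ≤ δ x) (hD : 0 < ∑ x ∈ Δ, δ x ^ 2) (r : ℝ) :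
    μ.real {U | F U - ∫ U', F U' ∂μ ≤ -r} ≤ Real.exp (2 / 3) * Real.exp (-r / Real.sqrt (2 * ((1 / 2 - 6 * b) / (1 - 48 * b)) * ∑ x ∈ Δ, δ x ^ 2)) := by
  have habs : |b| = b := abs_of_nonneg hb0
  have hden : 0 < 1 / 2 - 6 * b := by linarith
  have hc1 : 18 * b / (1 / 2 - 6 * b) < 1 := by rw [div_lt_one hden]; linarith
  have key := gibbs_measureReal_deviation_le_le_of_oneLinkKRModulus (d := 4) (N := N) (by norm_num) (by omega) (β := b) (K := 1 / (1 / 2 - 6 * b))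
    (by positivity) (R := 6 * b) (by rw [habs]; push_cast; linarith) (Balaban1983to89.StrongCouplingKernelWindow.oneLinkKRModulus_SU hN (by linarith))
    (c := 18 * b / (1 / 2 - 6 * b)) (by rw [habs]; push_cast; exact le_of_eq (by field_simp; ring)) hc1 hμ hF δ hδ hD r
  have e : (2 * (1 - 18 * b / (1 / 2 - 6 * b)))⁻¹ = (1 / 2 - 6 * b) / (1 - 48 * b) := by
    have e1 : 2 * (1 - 18 * b / (1 / 2 - 6 * b)) = (1 - 48 * b) / (1 / 2 - 6 * b) := by
      rw [eq_div_iff hden.ne']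
      have : 18 * b / (1 / 2 - 6 * b) * (1 / 2 - 6 * b) = 18 * b := div_mul_cancel₀ _ hden.ne'
      nlinarith [this]
    rw [e1, inv_div]
  rw [e] at key
  exact key

/-- ★★ **`SU(3)`, `d = 4`, HYPOTHESIS-FREE (twisted modulus) on `0 ≤ β_W < 1000/3531`, upper tail** (tree coupling `β_W/3`):
`μ{F − E_μ F ≥ r} ≤ e^{2/3} exp(−r/√(2(2(1 − 3531β_W/1000))⁻¹ ∑ δ_x²))` for every DLR state. [folklore] -/
theorem su3_gibbs_measureReal_deviation_ge_le_pv2t {βW : ℝ} (h0 : 0 ≤ βW) (h : βW < 1000 / 3531)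
    {μ : Measure (LGConfig 4 (Matrix.specialUnitaryGroup (Fin 3) ℂ))} (hμ : μ ∈ ymGibbsMeasures (d := 4) (fundamentalRep (Fin 3)) (βW / 3))
    {F : LGConfig 4 (Matrix.specialUnitaryGroup (Fin 3) ℂ) → ℝ} {Δ : Finset (ZdEdge 4)} {KF : ℝ≥0}
    (hF : IsLipschitzCylinder (fundamentalRep (Fin 3)) F Δ KF) (δ : ZdEdge 4 → ℝ)
    (hδ : ∀ x ∈ Δ, ∀ U s, |F U - F (update U x s)| ≤ δ x) (hD : 0 < ∑ x ∈ Δ, δ x ^ 2) (r : ℝ) :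
    μ.real {U | r ≤ F U - ∫ U', F U' ∂μ} ≤ Real.exp (2 / 3) * Real.exp (-r / Real.sqrt (2 * (2 * (1 - 3531 * βW / 1000))⁻¹ * ∑ x ∈ Δ, δ x ^ 2)) := by
  have hβ : ((3 : ℕ) : ℝ) * (βW / 9) = βW / 3 := by push_cast; ring
  have habs : |βW / 9| = βW / 9 := abs_of_nonneg (by positivity)
  have hμ9 : μ ∈ ymGibbsMeasures (d := 4) (fundamentalRep (Fin 3)) (((3 : ℕ) : ℝ) * (βW / 9)) := by rwa [hβ]
  exact gibbs_measureReal_deviation_ge_le_of_oneLinkKRModulus (d := 4) (N := 3) (by norm_num) (by norm_num) (β := βW / 9) (by norm_num) (R := 1 / 5)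
    (by rw [habs]; push_cast; linarith) TwistedBochner.su3_oneLinkKRModulus_pv2t_oneFifth (c := 3531 * βW / 1000)
    (by rw [habs]; push_cast; linarith) (by linarith) hμ9 hF δ hδ hD r

/-- ★★ **`SU(3)`, twisted modulus, lower tail**: `μ{F − E_μ F ≤ −r} ≤ e^{2/3} exp(−r/√(2(2(1 − 3531β_W/1000))⁻¹ ∑ δ_x²))`. [folklore] -/
theorem su3_gibbs_measureReal_deviation_le_le_pv2t {βW : ℝ} (h0 : 0 ≤ βW) (h : βW < 1000 / 3531)
    {μ : Measure (LGConfig 4 (Matrix.specialUnitaryGroup (Fin 3) ℂ))} (hμ : μ ∈ ymGibbsMeasures (d := 4) (fundamentalRep (Fin 3)) (βW / 3))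
    {F : LGConfig 4 (Matrix.specialUnitaryGroup (Fin 3) ℂ) → ℝ} {Δ : Finset (ZdEdge 4)} {KF : ℝ≥0}
    (hF : IsLipschitzCylinder (fundamentalRep (Fin 3)) F Δ KF) (δ : ZdEdge 4 → ℝ)
    (hδ : ∀ x ∈ Δ, ∀ U s, |F U - F (update U x s)| ≤ δ x) (hD : 0 < ∑ x ∈ Δ, δ x ^ 2) (r : ℝ) :
    μ.real {U | F U - ∫ U', F U' ∂μ ≤ -r} ≤ Real.exp (2 / 3) * Real.exp (-r / Real.sqrt (2 * (2 * (1 - 3531 * βW / 1000))⁻¹ * ∑ x ∈ Δ, δ x ^ 2)) := by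
  have hβ : ((3 : ℕ) : ℝ) * (βW / 9) = βW / 3 := by push_cast; ring
  have habs : |βW / 9| = βW / 9 := abs_of_nonneg (by positivity)
  have hμ9 : μ ∈ ymGibbsMeasures (d := 4) (fundamentalRep (Fin 3)) (((3 : ℕ) : ℝ) * (βW / 9)) := by rwa [hβ]
  exact gibbs_measureReal_deviation_le_le_of_oneLinkKRModulus (d := 4) (N := 3) (by norm_num) (by norm_num) (β := βW / 9) (by norm_num) (R := 1 / 5)
    (by rw [habs]; push_cast; linarith) TwistedBochner.su3_oneLinkKRModulus_pv2t_oneFifth (c := 3531 * βW / 1000)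
    (by rw [habs]; push_cast; linarith) (by linarith) hμ9 hF δ hδ hD r

/-- ★★ **`SU(2)`, `d = 4`, `0 ≤ β_W < 2/9`: concentration for every tight infinite-volume LIMIT of the torus Wilson states, upper tail** (every limit point is a
DLR state, Georgii Thm. 4.17): `μ{F − E_μ F ≥ r} ≤ e^{2/3} exp(−r/√(2(2 − 9β_W)⁻¹ ∑ δ_x²))`. [folklore] -/
theorem su2_limit_measureReal_deviation_ge_le {βW : ℝ} (h0 : 0 ≤ βW) (h : βW < 2 / 9)
    {μ : Measure (LGConfig 4 (Matrix.specialUnitaryGroup (Fin 2) ℂ))}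
    (hμ : μ ∈ infiniteVolumeLimitPoints (d := 4) (fundamentalRep (Fin 2)) (βW / 2))
    {F : LGConfig 4 (Matrix.specialUnitaryGroup (Fin 2) ℂ) → ℝ} {Δ : Finset (ZdEdge 4)} {KF : ℝ≥0}
    (hF : IsLipschitzCylinder (fundamentalRep (Fin 2)) F Δ KF) (δ : ZdEdge 4 → ℝ)
    (hδ : ∀ x ∈ Δ, ∀ U s, |F U - F (update U x s)| ≤ δ x) (hD : 0 < ∑ x ∈ Δ, δ x ^ 2) (r : ℝ) :
    μ.real {U | r ≤ F U - ∫ U', F U' ∂μ} ≤ Real.exp (2 / 3) * Real.exp (-r / Real.sqrt (2 * (2 - 9 * βW)⁻¹ * ∑ x ∈ Δ, δ x ^ 2)) := by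
  haveI : SecondCountableTopology (Matrix (Fin 2) (Fin 2) ℂ) := inferInstanceAs (SecondCountableTopology (Fin 2 → Fin 2 → ℂ))
  haveI : SecondCountableTopology (Matrix.specialUnitaryGroup (Fin 2) ℂ) := Topology.IsEmbedding.subtypeVal.secondCountableTopology
  have hG : μ ∈ ymGibbsMeasures (d := 4) (fundamentalRep (Fin 2)) (βW / 2) :=
    mem_ymGibbsMeasures_of_mem_infiniteVolumeLimitPoints_holds (fundamentalRep (Fin 2)) (continuous_fundamentalRep (Fin 2)) hμ
  exact su2_gibbs_measureReal_deviation_ge_le h0 h hG hF δ hδ hD r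

/-- ★★ **`SU(2)`, `d = 4`, `0 ≤ β_W < 2/9`, limit states, lower tail**: `μ{F − E_μ F ≤ −r} ≤ e^{2/3} exp(−r/√(2(2 − 9β_W)⁻¹ ∑ δ_x²))`. [folklore] -/
theorem su2_limit_measureReal_deviation_le_le {βW : ℝ} (h0 : 0 ≤ βW) (h : βW < 2 / 9)
    {μ : Measure (LGConfig 4 (Matrix.specialUnitaryGroup (Fin 2) ℂ))}
    (hμ : μ ∈ infiniteVolumeLimitPoints (d := 4) (fundamentalRep (Fin 2)) (βW / 2))
    {F : LGConfig 4 (Matrix.specialUnitaryGroup (Fin 2) ℂ) → ℝ} {Δ : Finset (ZdEdge 4)} {KF : ℝ≥0}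
    (hF : IsLipschitzCylinder (fundamentalRep (Fin 2)) F Δ KF) (δ : ZdEdge 4 → ℝ)
    (hδ : ∀ x ∈ Δ, ∀ U s, |F U - F (update U x s)| ≤ δ x) (hD : 0 < ∑ x ∈ Δ, δ x ^ 2) (r : ℝ) :
    μ.real {U | F U - ∫ U', F U' ∂μ ≤ -r} ≤ Real.exp (2 / 3) * Real.exp (-r / Real.sqrt (2 * (2 - 9 * βW)⁻¹ * ∑ x ∈ Δ, δ x ^ 2)) := by
  haveI : SecondCountableTopology (Matrix (Fin 2) (Fin 2) ℂ) := inferInstanceAs (SecondCountableTopology (Fin 2 → Fin 2 → ℂ))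
  haveI : SecondCountableTopology (Matrix.specialUnitaryGroup (Fin 2) ℂ) := Topology.IsEmbedding.subtypeVal.secondCountableTopology
  have hG : μ ∈ ymGibbsMeasures (d := 4) (fundamentalRep (Fin 2)) (βW / 2) :=
    mem_ymGibbsMeasures_of_mem_infiniteVolumeLimitPoints_holds (fundamentalRep (Fin 2)) (continuous_fundamentalRep (Fin 2)) hμ
  exact su2_gibbs_measureReal_deviation_le_le h0 h hG hF δ hδ hD r

end Summit.Ventures.YMGap.RobustBall.HeatBathConcentration

end
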